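import Summits.BirchSwinnertonDyer.BirchSwinnertonDyer.Theorems.ErratumRoadFiveRegCertKernelFiveDepthKSeries
import HarnessLib

/-!
# Route `ErratumRoadFive` (rung K2, `p ≥ 5`), crux `RamNoErratumDataAtFive` (item stmt-BirchSwinnertonDyer-19624, REST‴):
# the GENERIC first-order REG5CERT kernel checker AT ARBITRARY DEPTH `K ≥ 1` (`‖z(Q)‖₅ = 5⁻ᴷ`) — the depth-`K` twin of seat g7's
# `certNonsplit_of_certDepthOne ∕ …DepthTwo`, part 2: the certificate and its `CertNonsplit`
# wrapper (the parametric series estimates are part 1, `…RegCertKernelFiveDepthKSeries.lean`) (cell `bsd-stepL`, OWNER seat `bsd-stepL-rest-p2` g8; `--supports stmt-BirchSwinnertonDyer-19624`)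

HONEST FRAMING: BSD is not proved by any of this; nothing here closes the crux; Schneider's non-degeneracy conjecture
(barrier `Literature.Barriers.BirchSwinnertonDyer.PAdicHeightNondegeneracy`) is asserted NOWHERE; every application is ONE curve.
WHY (census HOME/rest/DEEPCENSUS-REST4at5.md v3): of the 4 114 NON-split REST⁗@5 pairs of Cremona's range, 326 have their first admissible point at
a level `k₀ > ν = v₅(Δ)` — out of the regime `k ≤ ν` of seat tam3-p2's exact (4.1) row checker — and 293 of those have `v₅(ĥ(Q)) ≤ k₀`, i.e. are
decided by the FIRST-ORDER argument at depth `k₀ ∈ {3, 4, 5}`, which has NO `ν`-regime (the scale `C²` cancels; only `5 ∤ c₄c₆` enters). The member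
TR8 = 3510j1 ⊗ 857 of crux 19624's TR (`Q = 40·g`, depth 3, `ν = 2`, `v₅(ĥ₄.₁(Q)) = 2`, `λ = 504`, `λ⁸ − e'⁸ ≡ 175 (mod 625)`) is such a row
(its (4.1) half; file `…Rest3TRLeverCertKernelSplit41B.lean` next). The argument is g7's verbatim with `25 ↦ 5ᴷ`: `den x = 5^{2K}e'²`,
`log_Ŵ(z) ≡ 5ᴷλ (mod 5^{−(2K+1)})` from `5^{K+1} ∣ −2ae'b + 5ᴷa₁a²e'² − 2λb²`, `C²σ² ≡ 5^{2K}λ² (mod 5^{2K}·5^{−(K+1)})`, and equal Iwasawa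
logarithms would force `5^{K+1} ∣ λ⁸ − e'⁸` (`padicLog_ne_padicLog_of_unitResidue`, `P = 5^{2K}`, `N = K + 1`).

* part 1: the estimates; THIS FILE: §2 `heightFourOneCoord_ne_zero_of_certDepth`; §3 `certNonsplit_of_certDepth` (one bundled integer hypothesis; per row `norm_num`).
Theorems only (0 defs, 0 facts, no `native_decide`); route-free. References: [SteinWuthrich2013] §4.2; [MazurSteinTate2006] §1;
[SilvermanAEC2009] IV.6.3–6.4, VII.3.4; [Iwasawa1972PadicL] §4.4.
-/

open scoped Classical

open Filter Topology PowerSeries IsUltrametricDist WeierstrassCurve Literature.NumberTheory.EllipticCurves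
  Literature.NumberTheory.EllipticCurves.Rank1Residual
  Literature.NumberTheory.EllipticCurves.SteinWuthrich2013
  Summit.BirchSwinnertonDyer.Rank1Residual
  Summit.BirchSwinnertonDyer.Rank1Residual.X11b
  Summit.BirchSwinnertonDyer.Rank1Residual.X11b.RegMult.Rung62310y1

namespace Summit.BirchSwinnertonDyer.Rank1Residual.X11b.RegMult.KernelCertFive
/-! ### §0 Plumbing -/

/-- `‖5^k‖₅ = 1/5^k`. [folklore] -/
private theorem norm_five_pow₉ (k : ℕ) : ‖(5 : ℚ_[5]) ^ k‖ = 1 / (5 : ℝ) ^ k := by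
  rw [norm_pow, show (5 : ℚ_[5]) = ((5 : ℕ) : ℚ_[5]) by norm_cast, Padic.norm_p]; simp

/-- `1/5ⁿ ≤ 1/5ᵐ` for `m ≤ n`. [folklore] -/
private theorem fifth_pow_le₉ {m n : ℕ} (h : m ≤ n) : 1 / (5 : ℝ) ^ n ≤ 1 / (5 : ℝ) ^ m :=
  one_div_le_one_div_of_le (by positivity) (pow_le_pow_right₀ (by norm_num) h)

/-- `1/5ᵐ · 1/5ⁿ = 1/5^{m+n}`. [folklore] -/
private theorem fifth_pow_mul₉ (m n : ℕ) : 1 / (5 : ℝ) ^ m * (1 / (5 : ℝ) ^ n) = 1 / (5 : ℝ) ^ (m + n) := by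
  rw [pow_add]; field_simp

/-! ### §2 The first-order height certificate at depth `K` -/

section Height

variable (W : WeierstrassCurve ℚ) {a₁ a₂ a₃ a₄ a₆ : ℤ} (hW : W = ⟨a₁, a₂, a₃, a₄, a₆⟩)

/-- `x = a/e²` in lowest terms has `den x = e²`. [folklore] -/
private theorem den_eq_sq₈ {a : ℤ} {e : ℕ} (he : e ≠ 0) (hcop : Nat.Coprime a.natAbs e) {x : ℚ}
    (hx : x = a / (e : ℚ) ^ 2) : x.den = e ^ 2 := by
  have hpos : (0 : ℤ) < ((e : ℕ) : ℤ) ^ 2 := by positivity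
  have hcop2 : Nat.Coprime a.natAbs ((((e : ℕ) : ℤ) ^ 2).natAbs) := by
    rw [Int.natAbs_pow, Int.natAbs_natCast]; exact hcop.pow_right 2
  have h := Rat.den_div_eq_of_coprime hpos hcop2
  have hx' : x = ((a : ℤ) : ℚ) / ((((e : ℕ) : ℤ) ^ 2 : ℤ) : ℚ) := by rw [hx]; push_cast; ring
  rw [← hx'] at h
  exact_mod_cast h

/-- `gcd(a, 5ᴷe') = 1 ⇒ 5 ∤ a` (`K ≥ 1`). [folklore] -/
private theorem not_five_dvd_of_coprime₈ {a : ℤ} {e' K : ℕ} (hK : K ≠ 0) (hcop : Nat.Coprime a.natAbs (5 ^ K * e')) :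
    ¬ (5 : ℤ) ∣ a := by
  intro h
  have h1 : 5 ∣ a.natAbs := Int.natCast_dvd.mp h
  have h2 : 5 ∣ Nat.gcd a.natAbs (5 ^ K * e') := Nat.dvd_gcd h1 (dvd_mul_of_dvd_left (dvd_pow_self 5 hK) e')
  rw [hcop] at h2
  exact absurd (Nat.le_of_dvd one_pos h2) (by norm_num)

include hW in
/-- **The first-order REG5CERT certificate at DEPTH `K ≥ 1`** (generic form of `…certDepthOne` ∕ `…certDepthTwo`). Let `W/ℚ` be globally
minimal with integer model `⟨a₁,…,a₆⟩` whose `c₄, c₆` are `5`-adic units; `Q = (x, y) = (a/e², b/e³)` with `e = 5ᴷe'`, `5 ∤ e'`, `5 ∤ b`,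
`gcd(a, e) = 1` (so `‖z(Q)‖₅ = 5⁻ᴷ`); `λ` an integer with `5^{K+1} ∣ −2ae'b + 5ᴷa₁a²e'² − 2λb²` (`log_Ŵ(z) ≡ 5ᴷλ (mod 5^{−(2K+1)})`), `5 ∤ λ`.
If **`5^{K+1} ∤ λ⁸ − e'⁸`** then `heightFourOneCoord W 5 q x y ≠ 0` for EVERY `‖q‖₅ < 1`: `h = log₅(den x) − log₅(C²σ²)`, `den x = 5^{2K}e'²`,
`C²σ² = log_Ŵ(z)²(1 + O(5^{−2K})) ≡ 5^{2K}λ² (mod 5^{2K}·5^{−(K+1)})`, and equal logarithms force `5^{K+1} ∣ (λ²)⁴ − (e'²)⁴`. It decides the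
height exactly when `v₅(ĥ(Q)) ≤ K`. [cite: SteinWuthrich2013, §4.2] [cite: Iwasawa1972PadicL, §4.4] [cite: SilvermanAEC2009, IV.6.4] -/
theorem heightFourOneCoord_ne_zero_of_certDepth [W.IsGloballyMinimal] {K : ℕ} (hK : 1 ≤ K) {a b c4 c6 lam : ℤ} {e' : ℕ}
    (hc4 : c4 = (a₁ ^ 2 + 4 * a₂) ^ 2 - 24 * (2 * a₄ + a₁ * a₃))
    (hc6 : c6 = -(a₁ ^ 2 + 4 * a₂) ^ 3 + 36 * (a₁ ^ 2 + 4 * a₂) * (2 * a₄ + a₁ * a₃) - 216 * (a₃ ^ 2 + 4 * a₆))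
    (h5c4 : ¬ (5 : ℤ) ∣ c4) (h5c6 : ¬ (5 : ℤ) ∣ c6) (h5e : ¬ (5 : ℤ) ∣ e') (h5b : ¬ (5 : ℤ) ∣ b)
    (hcop : Nat.Coprime a.natAbs (5 ^ K * e'))
    {x y : ℚ} (hx : x = a / ((5 ^ K * e' : ℕ) : ℚ) ^ 2) (hy : y = b / ((5 ^ K * e' : ℕ) : ℚ) ^ 3)
    (hlam : (5 : ℤ) ^ (K + 1) ∣ -2 * a * e' * b + 5 ^ K * a₁ * a ^ 2 * e' ^ 2 - 2 * lam * b ^ 2) (h5lam : ¬ (5 : ℤ) ∣ lam)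
    (hcert : ¬ (5 : ℤ) ^ (K + 1) ∣ (lam ^ 2) ^ 4 - ((e' : ℤ) ^ 2) ^ 4)
    {q : ℚ_[5]} (hq : ‖q‖ < 1) : heightFourOneCoord W 5 q x y ≠ 0 := by
  have hK0 : K ≠ 0 := by omega
  have h5a : ¬ (5 : ℤ) ∣ a := not_five_dvd_of_coprime₈ hK0 hcop
  have he'0 : e' ≠ 0 := by rintro rfl; exact h5e (by simp)
  set V := W.baseChange ℚ_[5] with hV
  have ha1 : V.a₁ = a₁ := baseChange_a₁_eq W hW
  -- the scale `5ᴷ` in `ℚ₅`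
  set F : ℚ_[5] := (5 : ℚ_[5]) ^ K with hF
  have hFn : ‖F‖ = 1 / (5 : ℝ) ^ K := norm_five_pow₉ K
  have hF0 : F ≠ 0 := pow_ne_zero _ (by norm_num)
  -- the parameter `z = −x/y = −5ᴷae'/b`, `‖z‖ = 5⁻ᴷ`
  set z : ℚ_[5] := -(x : ℚ_[5]) / y with hz
  have hbn : ‖(b : ℚ_[5])‖ = 1 := norm_intCast_eq_one_of_not_dvd h5b
  have hb0 : (b : ℚ_[5]) ≠ 0 := by intro h; rw [h, norm_zero] at hbn; exact zero_ne_one hbn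
  have hen : ‖((e' : ℤ) : ℚ_[5])‖ = 1 := norm_intCast_eq_one_of_not_dvd h5e
  have he0 : ((e' : ℤ) : ℚ_[5]) ≠ 0 := by intro h; rw [h, norm_zero] at hen; exact zero_ne_one hen
  have he0' : (e' : ℚ_[5]) ≠ 0 := by exact_mod_cast he0
  have hae : ‖((-a * e' : ℤ) : ℚ_[5])‖ = 1 := by
    rw [Int.cast_mul, norm_mul, Int.cast_neg, norm_neg, norm_intCast_eq_one_of_not_dvd h5a, hen, one_mul]
  have hzval : z = F * ((-a * e' : ℤ) : ℚ_[5]) / (b : ℚ_[5]) := by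
    rw [hz, hx, hy, hF]; push_cast; field_simp
  have hzn : ‖z‖ = 1 / (5 : ℝ) ^ K := by rw [hzval, norm_div, norm_mul, hFn, hae, hbn]; norm_num
  -- the formal logarithm to second order and the residue `λ`
  have hFL := norm_padicFormalLog_sub_quadratic_le_depth V hK hzn.le
  rw [ha1] at hFL
  have hres : ‖(z + (2 : ℚ_[5])⁻¹ * (a₁ : ℚ_[5]) * z ^ 2) - F * (lam : ℚ_[5])‖ ≤ 1 / (5 : ℝ) ^ (2 * K + 1) := by
    have hid : (z + (2 : ℚ_[5])⁻¹ * (a₁ : ℚ_[5]) * z ^ 2) - F * (lam : ℚ_[5]) =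
        F * (((-2 * a * e' * b + 5 ^ K * a₁ * a ^ 2 * e' ^ 2 - 2 * lam * b ^ 2 : ℤ)) : ℚ_[5]) /
          ((2 * b ^ 2 : ℤ) : ℚ_[5]) := by
      have h20 : (2 : ℚ_[5]) ≠ 0 := by norm_num
      rw [hzval, hF]; push_cast; field_simp
    rw [hid, norm_div, norm_mul, hFn]
    have hKn : ‖(((-2 * a * e' * b + 5 ^ K * a₁ * a ^ 2 * e' ^ 2 - 2 * lam * b ^ 2 : ℤ)) : ℚ_[5])‖ ≤ 1 / (5 : ℝ) ^ (K + 1) := by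
      have h := (Padic.norm_int_le_pow_iff_dvd (p := 5) (-2 * a * e' * b + 5 ^ K * a₁ * a ^ 2 * e' ^ 2 - 2 * lam * b ^ 2) (K + 1)).mpr
        (by exact_mod_cast hlam)
      refine h.trans (le_of_eq ?_)
      rw [one_div, ← zpow_natCast, ← zpow_neg]; norm_cast
    have hD : ‖((2 * b ^ 2 : ℤ) : ℚ_[5])‖ = 1 :=
      norm_intCast_eq_one_of_not_dvd (by
        intro h
        have h2 : (5 : ℤ) ∣ b ^ 2 :=
          ((Int.prime_iff_natAbs_prime.mpr (by norm_num) : Prime (5 : ℤ)).dvd_or_dvd h).resolve_left (by norm_num)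
        exact not_five_dvd_sq h5b h2)
    rw [hD, div_one]
    calc 1 / (5 : ℝ) ^ K * ‖(((-2 * a * e' * b + 5 ^ K * a₁ * a ^ 2 * e' ^ 2 - 2 * lam * b ^ 2 : ℤ)) : ℚ_[5])‖
        ≤ 1 / (5 : ℝ) ^ K * (1 / (5 : ℝ) ^ (K + 1)) := by gcongr
      _ = 1 / (5 : ℝ) ^ (2 * K + 1) := by rw [fifth_pow_mul₉]; congr 2; ring
  have hL : ‖V.padicFormalLog z - F * (lam : ℚ_[5])‖ ≤ 1 / (5 : ℝ) ^ (2 * K + 1) := by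
    have : V.padicFormalLog z - F * (lam : ℚ_[5]) = (V.padicFormalLog z - (z + (2 : ℚ_[5])⁻¹ * (a₁ : ℚ_[5]) * z ^ 2)) +
        ((z + (2 : ℚ_[5])⁻¹ * (a₁ : ℚ_[5]) * z ^ 2) - F * (lam : ℚ_[5])) := by ring
    rw [this]
    exact (IsUltrametricDist.norm_add_le_max _ _).trans (max_le (hFL.trans (fifth_pow_le₉ (by omega))) hres)
  have hlamn : ‖(lam : ℚ_[5])‖ = 1 := norm_intCast_eq_one_of_not_dvd h5lam
  have h5lamn : ‖(F * (lam : ℚ_[5]))‖ = 1 / (5 : ℝ) ^ K := by rw [norm_mul, hFn, hlamn, mul_one]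
  have hLn : ‖V.padicFormalLog z‖ = 1 / (5 : ℝ) ^ K := by
    have hlt : ‖V.padicFormalLog z - F * (lam : ℚ_[5])‖ < ‖(F * (lam : ℚ_[5]))‖ := by
      rw [h5lamn]
      refine hL.trans_lt ?_
      exact one_div_lt_one_div_of_lt (by positivity) (pow_lt_pow_right₀ (by norm_num) (by omega))
    rw [Padic.norm_eq_of_norm_sub_lt_right hlt, h5lamn]
  -- the sigma function: `C²σ² = L² + O(5^{−4K})`, `L² = 5^{2K}λ² + O(5^{−(3K+1)})`
  set L := V.padicFormalLog z with hLdef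
  set C2 := uniformisationScaleSq W 5 q with hC2def
  have hC2 : ‖C2‖ = 1 := norm_uniformisationScaleSq_eq_one_of_units W hW hc4 hc6 h5c4 h5c6 hq
  have hC20 : C2 ≠ 0 := uniformisationScaleSq_ne_zero_of_units W hW hc4 hc6 h5c4 h5c6 hq
  have hwdef : logUnitParamSq W 5 q x y = L ^ 2 / C2 := by rw [logUnitParamSq]
  set w := logUnitParamSq W 5 q x y with hw
  have hwn : ‖w‖ = 1 / (5 : ℝ) ^ (2 * K) := by
    rw [hwdef, norm_div, norm_pow, hLn, hC2, div_one, one_div_pow, ← pow_mul, mul_comm]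
  have hw25 : ‖w‖ ≤ 1 / 25 := by
    rw [hwn, show (25 : ℝ) = (5 : ℝ) ^ 2 by norm_num]; exact fifth_pow_le₉ (by omega)
  have hS := norm_tateSigmaSq_coshOfSq_sub_le_sq hq hw25
  set S2 := tateSigmaSq q (coshOfSq w) with hS2
  have hCw : C2 * w = L ^ 2 := by rw [hwdef]; field_simp
  have hB1 : ‖C2 * S2 - L ^ 2‖ ≤ 1 / (5 : ℝ) ^ (4 * K) := by
    rw [← hCw, ← mul_sub, norm_mul, hC2, one_mul]
    refine hS.trans (le_of_eq ?_)
    rw [hwn, one_div_pow, ← pow_mul]; congr 2; ring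
  have hB2 : ‖L ^ 2 - (F * (lam : ℚ_[5])) ^ 2‖ ≤ 1 / (5 : ℝ) ^ (3 * K + 1) := by
    rw [sq_sub_sq, norm_mul]
    have hplus : ‖L + F * (lam : ℚ_[5])‖ ≤ 1 / (5 : ℝ) ^ K :=
      (IsUltrametricDist.norm_add_le_max _ _).trans (max_le hLn.le h5lamn.le)
    calc ‖L + F * (lam : ℚ_[5])‖ * ‖L - F * (lam : ℚ_[5])‖ ≤ 1 / (5 : ℝ) ^ K * (1 / (5 : ℝ) ^ (2 * K + 1)) := by
          gcongr
      _ = 1 / (5 : ℝ) ^ (3 * K + 1) := by rw [fifth_pow_mul₉]; congr 2; ring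
  have hF2n : ‖F ^ 2‖ = 1 / (5 : ℝ) ^ (2 * K) := by rw [norm_pow, hFn, one_div_pow, ← pow_mul, mul_comm]
  have hF2 : F ^ 2 = (5 : ℚ_[5]) ^ (2 * K) := by rw [hF, ← pow_mul, mul_comm]
  have htarget : ‖(5 : ℚ_[5]) ^ (2 * K)‖ / (5 : ℝ) ^ (K + 1) = 1 / (5 : ℝ) ^ (3 * K + 1) := by
    rw [norm_five_pow₉, div_div, ← pow_add]; congr 2; ring
  have hB : ‖C2 * S2 - (5 : ℚ_[5]) ^ (2 * K) * (((lam ^ 2 : ℤ)) : ℚ_[5])‖ ≤ ‖(5 : ℚ_[5]) ^ (2 * K)‖ / (5 : ℝ) ^ (K + 1) := by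
    have hid : C2 * S2 - (5 : ℚ_[5]) ^ (2 * K) * (((lam ^ 2 : ℤ)) : ℚ_[5]) = (C2 * S2 - L ^ 2) + (L ^ 2 - (F * (lam : ℚ_[5])) ^ 2) := by
      rw [← hF2]; push_cast; ring
    rw [hid, htarget]
    refine (IsUltrametricDist.norm_add_le_max _ _).trans (max_le (hB1.trans (fifth_pow_le₉ (by omega))) hB2)
  -- `den x = e² = 5^{2K}e'²`
  have he0n : (5 ^ K * e' : ℕ) ≠ 0 := by positivity
  have hden : x.den = (5 ^ K * e') ^ 2 := den_eq_sq₈ he0n hcop hx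
  have hA : ‖(((x.den : ℚ)) : ℚ_[5]) - (5 : ℚ_[5]) ^ (2 * K) * ((((e' : ℤ)) ^ 2 : ℤ) : ℚ_[5])‖ ≤
      ‖(5 : ℚ_[5]) ^ (2 * K)‖ / (5 : ℝ) ^ (K + 1) := by
    have h0 : (((x.den : ℚ)) : ℚ_[5]) - (5 : ℚ_[5]) ^ (2 * K) * ((((e' : ℤ)) ^ 2 : ℤ) : ℚ_[5]) = 0 := by
      rw [hden]; push_cast; ring
    rw [h0, norm_zero]
    positivity
  -- the assembly
  intro h0
  rw [heightFourOneCoord] at h0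
  have heq : padicLog 5 (((x.den : ℚ)) : ℚ_[5]) = padicLog 5 (C2 * S2) := sub_eq_zero.mp h0
  exact padicLog_ne_padicLog_of_unitResidue (P := (5 : ℚ_[5]) ^ (2 * K)) (pow_ne_zero _ (by norm_num))
    (not_five_dvd_sq h5e) (not_five_dvd_sq h5lam) (by omega : 1 ≤ K + 1) hA hB hcert heq

end Height

/-! ### §3 The admissible certificate `RegMult.CertNonsplit W 5 Q 1` at depth `K` -/

/-- **`RegMult.CertNonsplit W 5 Q 1` from a DEPTH-`K` first-order REG5CERT certificate** (`e = 5ᴷe'`, `K ≥ 1`; residue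
`5^{K+1} ∣ −2ae'b + 5ᴷa₁a²e'² − 2λb²`; certificate **`5^{K+1} ∤ λ⁸ − e'⁸`**): the single hypothesis `H` bundles the row's integer facts —
`c₄, c₆` prime to `5`, `5 ∤ e'`, `5 ∤ b`, `gcd(a, e) = 1`, the gcd reduction test `gcd(Φ_y·e³, Φ_x·e⁴) ∣ eⁿ`, the residue and the certificate —
decided per row by ONE `norm_num`. Per curve; nothing class-wide. [cite: SteinWuthrich2013, §4.2] [cite: MazurSteinTate2006, §1]
[cite: SilvermanAEC2009, VII.3.4] -/
theorem certNonsplit_of_certDepth (W : WeierstrassCurve ℚ) {a₁ a₂ a₃ a₄ a₆ : ℤ} (hW : W = ⟨a₁, a₂, a₃, a₄, a₆⟩)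
    [W.IsElliptic] [W.IsGloballyMinimal] (K : ℕ) {a b c4 c6 lam : ℤ} {e' n : ℕ}
    (H : 1 ≤ K ∧ c4 = (a₁ ^ 2 + 4 * a₂) ^ 2 - 24 * (2 * a₄ + a₁ * a₃) ∧
      c6 = -(a₁ ^ 2 + 4 * a₂) ^ 3 + 36 * (a₁ ^ 2 + 4 * a₂) * (2 * a₄ + a₁ * a₃) - 216 * (a₃ ^ 2 + 4 * a₆) ∧
      ¬ (5 : ℤ) ∣ c4 ∧ ¬ (5 : ℤ) ∣ c6 ∧ ¬ (5 : ℤ) ∣ e' ∧ ¬ (5 : ℤ) ∣ b ∧ Nat.Coprime a.natAbs (5 ^ K * e') ∧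
      Int.gcd (2 * b + a₁ * a * (5 ^ K * e' : ℕ) + a₃ * (5 ^ K * e' : ℕ) ^ 3)
        (a₁ * b * (5 ^ K * e' : ℕ) - (3 * a ^ 2 + 2 * a₂ * a * (5 ^ K * e' : ℕ) ^ 2 + a₄ * (5 ^ K * e' : ℕ) ^ 4)) ∣ (5 ^ K * e') ^ n ∧
      (5 : ℤ) ^ (K + 1) ∣ -2 * a * e' * b + 5 ^ K * a₁ * a ^ 2 * e' ^ 2 - 2 * lam * b ^ 2 ∧ ¬ (5 : ℤ) ∣ lam ∧
      ¬ (5 : ℤ) ^ (K + 1) ∣ (lam ^ 2) ^ 4 - ((e' : ℤ) ^ 2) ^ 4)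
    {x y : ℚ} (hx : x = a / ((5 ^ K * e' : ℕ) : ℚ) ^ 2) (hy : y = b / ((5 ^ K * e' : ℕ) : ℚ) ^ 3)
    (h : W.toAffine.Nonsingular x y) : RegMult.CertNonsplit W 5 (.some x y h) 1 := by
  obtain ⟨hK, hc4, hc6, h5c4, h5c6, h5e, h5b, hcop, hgcd, hlam, h5lam, hcert⟩ := H
  have he'0 : e' ≠ 0 := by rintro rfl; exact h5e (by simp)
  have he0 : (5 ^ K * e' : ℕ) ≠ 0 := by positivity
  have hx1 : 1 < ‖(x : ℚ_[5])‖ :=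
    (one_lt_norm_ratCast_iff 5 x).mpr (KernelCert.padicValRat_x_neg he0 hx hcop
      (dvd_mul_of_dvd_left (dvd_pow_self 5 (by omega)) e'))
  have hadm : W.IsAdmissible 5 (.some x y h) :=
    isAdmissible_of_one_lt_norm (by norm_num) h hx1 (KernelCert.hasNonsingularReductionAt_of_gcd W hW he0 hx hy hcop hgcd)
  refine ⟨by rw [one_smul]; exact hadm, fun q _ hq1 _ => ?_⟩
  rw [one_smul]
  exact heightFourOneCoord_ne_zero_of_certDepth W hW hK hc4 hc6 h5c4 h5c6 h5e h5b hcop hx hy hlam h5lam hcert hq1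

end Summit.BirchSwinnertonDyer.Rank1Residual.X11b.RegMult.KernelCertFive
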